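import Summits.Ventures.PercRepro.MSRMStarPairMain

/-!
# No residue instance has `u = univ` — Conjecture V on residue instances

Dossier proofs/MINE1-theoremS.md, Addendum 64. For `u = univ` the signs of a residue instance say
that every member `t` is a difference or has its complement a difference; `F ∪ {∅}` not tight
says that some member `t₀` is not a difference (`exists_notMem_diffs_of_residue_univ`). At a
tight complex trace `r` ({r} ∈ F`, after the complementation symmetry) Case I (`univ ∖ r ∈ F`)
makes every member a difference (`residue_diffs_eq_of_caseI`); in Case II the non-difference
member is `r`-lifted, `t₀ = t₁ ∪ r` with `t₁ ∉ Y` a face meeting every member avoiding `r`, and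
the count `|Y| = |K| + 1` decides: if some partner member `k` is not free, `S' ∖ k` is a face
which is not a member (it avoids `k`), so it is `r`-lifted and `(univ ∖ k, k)` is a complementary
pair; if every partner member is free, `Y = K ∪ {∅}` and every singleton `{a}` is a member
avoiding `r` (an `r`-lifted `{a}` has `{a} ∖ s ∈ Y` for every member `s`, so `a` lies in every
member unless `{a} ∈ K` — but a free partner member and its witness are disjoint), whence
`t₁ ⊇ S'` and `t₀ = univ ∈ F`. So `Residue F u → u ≠ univ` (`Residue.ne_univ`), `CaseIOfComplex α`
holds (`caseIOfComplex`), and **Conjecture V holds on every residue instance** (`conjV_residue`).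
-/

namespace PercRepro.MSTight

open Finset
open scoped FinsetFamily

variable {α : Type*} [DecidableEq α] [Fintype α]

section Univ

variable {F : Finset (Finset α)} {r : α}

omit [Fintype α] in
/-- `F ∪ {∅}` is tight when every member of the excess-one family `F` is a difference. -/
theorem tight_insert_empty_of_subset (hF : (F \\ F).card = F.card + 1) (hE : (∅ : Finset α) ∉ F)
    (hsub : F ⊆ F \\ F) : Tight (insert ∅ F) := by
  have hne : F.Nonempty := by
    by_contra hno
    rw [not_nonempty_iff_eq_empty] at hno
    subst hno
    simp at hF
  obtain ⟨t, ht⟩ := hne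
  have hE' : (∅ : Finset α) ∈ F \\ F := by
    have := Finset.sdiff_mem_diffs ht ht
    rwa [Finset.sdiff_self] at this
  have heq : insert ∅ F \\ insert ∅ F = F \\ F := by
    ext a
    constructor
    · intro ha
      obtain ⟨x, hx, y, hy, rfl⟩ := Finset.mem_diffs.1 ha
      rcases mem_insert.1 hx with rfl | hx
      · rw [empty_sdiff]; exact hE'
      · rcases mem_insert.1 hy with rfl | hy
        · rw [sdiff_empty]; exact hsub hx
        · exact Finset.sdiff_mem_diffs hx hy
    · intro ha
      obtain ⟨x, hx, y, hy, rfl⟩ := Finset.mem_diffs.1 ha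
      exact Finset.sdiff_mem_diffs (mem_insert_of_mem hx) (mem_insert_of_mem hy)
  unfold Tight
  rw [heq, hF, card_insert_of_notMem hE]

/-- In a residue instance with `u = univ`, some member is not a difference. -/
theorem exists_notMem_diffs_of_residue_univ (h : Residue F univ) : ∃ t ∈ F, t ∉ F \\ F := by
  by_contra hno
  simp only [not_exists, not_and, not_not] at hno
  apply h.hnt'
  rw [Finset.sdiff_self]
  exact tight_insert_empty_of_subset h.hexc h.hempty hno

/-- The signs of a residue instance with `u = univ`: every member is a difference or has its
complement a difference. -/
theorem mem_diffs_or_compl_mem_diffs_of_residue_univ (h : Residue F univ) {t : Finset α}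
    (ht : t ∈ F) : t ∈ F \\ F ∨ univ \ t ∈ F \\ F := by
  rcases h.hsig t ht with ⟨h1, -⟩ | ⟨-, h2⟩
  · left; rwa [inter_univ] at h1
  · right; rwa [Finset.sdiff_self, sdiff_empty, inter_univ] at h2

/-- `S' ∖ t = univ ∖ (t ∪ r)`. -/
theorem erase_sdiff_eq_univ_sdiff_insert (r : α) (t : Finset α) :
    univ.erase r \ t = univ \ insert r t := by
  ext a
  constructor
  · intro ha
    obtain ⟨ha1, ha2⟩ := mem_sdiff.1 ha
    exact mem_sdiff.2 ⟨mem_univ a, fun h => (mem_insert.1 h).elim (fun e => (mem_erase.1 ha1).1 e) ha2⟩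
  · intro ha
    obtain ⟨-, ha2⟩ := mem_sdiff.1 ha
    refine mem_sdiff.2 ⟨mem_erase.2 ⟨fun e => ha2 ?_, mem_univ a⟩, fun h => ha2 (mem_insert_of_mem h)⟩
    rw [e]
    exact mem_insert_self r t

/-- The signs (†) of a residue instance with `u = univ` at a complex tight trace, in the
vocabulary of the trace: an `r`-lifted face is free or its complement in `S'` is a face. -/
theorem sign_of_residue_univ (h : Residue F univ) (hP : Tight (proj r F))
    (hr : ({r} : Finset α) ∈ F) {t : Finset α} (ht : t ∈ partr r F) :
    t ∈ diffsY r F ∨ univ.erase r \ t ∈ proj r F := by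
  have hrt : r ∉ t := (mem_partr.1 ht).1
  rcases mem_diffs_or_compl_mem_diffs_of_residue_univ h (mem_partr.1 ht).2 with h1 | h2
  · exact Or.inl (mem_diffsY_iff.2 ⟨hrt, h1⟩)
  · right
    rw [← diffsX_eq_proj_of_singleton_mem hP hr]
    refine mem_diffsX_iff.2 ⟨?_, ?_⟩
    · rw [erase_sdiff_eq_univ_sdiff_insert]; exact h2
    · exact fun hr' => (mem_erase.1 (mem_sdiff.1 hr').1).1 rfl

/-- **No residue instance has `u = univ`, at a complex tight trace.** -/
theorem residue_univ_false_of_singleton (h : Residue F univ) (hP : Tight (proj r F))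
    (hr : ({r} : Finset α) ∈ F) : False := by
  have hsing : ∀ a, a ≠ r → ({a} : Finset α) ∈ proj r F := fun a ha =>
    singleton_mem_proj_of_twinFree h.hexc hP hr (fun a b hab => (h.htf a b hab).symm) h.hsupp ha
  -- Case I: every member is a difference
  by_cases hI : univ.erase r ∈ F
  · have hD := residue_diffs_eq_of_caseI h hP hr (mem_univ r) hI
    apply h.hnt'
    rw [Finset.sdiff_self]
    exact tight_insert_empty_of_subset h.hexc h.hempty (by rw [hD]; exact subset_insert _ _)
  -- the non-difference member is `r`-lifted: `t₀ = t₁ ∪ r`, `t₁ ∉ Y`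
  obtain ⟨t₀, ht₀, hnD⟩ := exists_notMem_diffs_of_residue_univ h
  have hrt₀ : r ∈ t₀ := by
    by_contra hrt
    apply hnD
    have := Finset.sdiff_mem_diffs ht₀ hr
    rwa [sdiff_singleton_eq_erase, erase_eq_of_notMem hrt] at this
  have ht₁ : t₀.erase r ∈ partr r F :=
    mem_partr.2 ⟨notMem_erase r t₀, by rw [insert_erase hrt₀]; exact ht₀⟩
  have hY₁ : t₀.erase r ∉ diffsY r F := fun hY => by
    have := (mem_diffsY_iff.1 hY).2
    rw [insert_erase hrt₀] at this
    exact hnD this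
  -- `t₁` meets every member avoiding `r`
  have hmeet : ∀ s ∈ part0 r F, ¬ Disjoint (t₀.erase r) s := by
    intro s hs hd
    apply hY₁
    have this : t₀.erase r \ s ∈ diffsY r F := Finset.sdiff_mem_diffs ht₁ hs
    rwa [Finset.sdiff_eq_self_of_disjoint hd] at this
  -- a member avoiding `r`
  obtain ⟨s₀, hs₀F, hrs₀⟩ := h.hcore r
  have hs₀ : s₀ ∈ part0 r F := mem_part0.2 ⟨hs₀F, hrs₀⟩
  have hcard := card_diffsY_of_singleton_mem hP hr h.hexc
  by_cases hKY : partner r F ⊆ diffsY r F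
  · -- every partner member is free: `Y = K ∪ {∅}`
    have hE0 : (∅ : Finset α) ∈ partr r F :=
      mem_partr.2 ⟨notMem_empty r, by rw [insert_empty]; exact hr⟩
    have hE : (∅ : Finset α) ∈ diffsY r F := by
      have this : (∅ : Finset α) \ s₀ ∈ diffsY r F := Finset.sdiff_mem_diffs hE0 hs₀
      rwa [empty_sdiff] at this
    have hEK : (∅ : Finset α) ∉ partner r F := fun h0 => h.hempty (mem_of_mem_partner h0)
    have hYeq : diffsY r F = insert ∅ (partner r F) :=
      (eq_of_subset_of_card_le (insert_subset hE hKY)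
        (by rw [card_insert_of_notMem hEK, hcard])).symm
    -- `K ≠ ∅`
    obtain ⟨k₀, hk₀⟩ : (partner r F).Nonempty := by
      by_contra hKe
      rw [not_nonempty_iff_eq_empty] at hKe
      rw [hKe, insert_empty] at hYeq
      have hsub₁ : t₀.erase r ⊆ s₀ := by
        have this : t₀.erase r \ s₀ ∈ diffsY r F := Finset.sdiff_mem_diffs ht₁ hs₀
        rw [hYeq, mem_singleton] at this
        exact sdiff_eq_empty_iff_subset.1 this
      rcases sign_of_residue_univ h hP hr ht₁ with hY | hW
      · exact hY₁ hY
      rcases RMStar.part0_or_partr hW with hW0 | hW1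
      · exact hmeet _ hW0 (Finset.disjoint_sdiff)
      · have hsub₂ : univ.erase r \ t₀.erase r ⊆ s₀ := by
          have this : (univ.erase r \ t₀.erase r) \ s₀ ∈ diffsY r F :=
            Finset.sdiff_mem_diffs hW1 hs₀
          rw [hYeq, mem_singleton] at this
          exact sdiff_eq_empty_iff_subset.1 this
        apply hI
        have : s₀ = univ.erase r := by
          refine Subset.antisymm (fun a ha => mem_erase.2 ⟨fun e => hrs₀ (e ▸ ha), mem_univ a⟩) ?_
          intro a ha
          by_cases hat : a ∈ t₀.erase r
          · exact hsub₁ hat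
          · exact hsub₂ (mem_sdiff.2 ⟨ha, hat⟩)
        exact this ▸ hs₀F
    have hk₀0 : k₀ ∈ part0 r F := mem_part0.2 ⟨(mem_partner_iff.1 hk₀).1, (mem_partner_iff.1 hk₀).2.1⟩
    -- every singleton of `S'` is a member avoiding `r`
    have hsingF0 : ∀ a, a ≠ r → ({a} : Finset α) ∈ part0 r F := by
      intro a har
      rcases RMStar.part0_or_partr (hsing a har) with h0 | h1
      · exact h0
      · by_contra hnot
        have hall : ∀ s ∈ part0 r F, a ∈ s := by
          intro s hs
          have hd : ({a} : Finset α) \ s ∈ diffsY r F := Finset.sdiff_mem_diffs h1 hs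
          rw [hYeq, mem_insert] at hd
          rcases hd with hd | hd
          · exact singleton_subset_iff.1 (sdiff_eq_empty_iff_subset.1 hd)
          · exfalso
            apply hnot
            rcases subset_singleton_iff.1 (sdiff_subset : {a} \ s ⊆ {a}) with he | he
            · rw [he] at hd; exact absurd hd hEK
            · rw [he] at hd
              exact mem_part0.2 ⟨(mem_partner_iff.1 hd).1, (mem_partner_iff.1 hd).2.1⟩
        obtain ⟨t, -, s'', hs'', hk₀eq⟩ := Finset.mem_diffs.1 (hKY hk₀)
        have h1' := hall _ hk₀0
        have h2' := hall _ hs''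
        rw [← hk₀eq] at h1'
        exact (mem_sdiff.1 h1').2 h2'
    -- hence `t₁ ⊇ S'` and `t₀ = univ`
    have hsub : univ.erase r ⊆ t₀.erase r := by
      intro a ha
      have har : a ≠ r := (mem_erase.1 ha).1
      by_contra hat
      exact hmeet _ (hsingF0 a har) (Finset.disjoint_singleton_right.2 hat)
    apply h.huniv
    have : t₀ = univ := by
      apply eq_univ_of_forall
      intro a
      by_cases har : a = r
      · rw [har]; exact hrt₀
      · exact mem_of_mem_erase (hsub (mem_erase.2 ⟨har, mem_univ a⟩))
    exact this ▸ ht₀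
  · -- a non-free partner member `k`: `(univ ∖ k, k)` is a complementary pair
    obtain ⟨k, hk, hkY⟩ := not_subset.1 hKY
    have hkF : k ∈ F := (mem_partner_iff.1 hk).1
    have hrk : r ∉ k := (mem_partner_iff.1 hk).2.1
    have hk1 : k ∈ partr r F := mem_partr.2 ⟨hrk, (mem_partner_iff.1 hk).2.2⟩
    rcases sign_of_residue_univ h hP hr hk1 with hY | hW
    · exact hkY hY
    rcases RMStar.part0_or_partr hW with hW0 | hW1
    · apply hkY
      have this : k \ (univ.erase r \ k) ∈ diffsY r F := Finset.sdiff_mem_diffs hk1 hW0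
      rwa [Finset.sdiff_eq_self_of_disjoint Finset.disjoint_sdiff] at this
    · apply h.hvalid k hkF
      have := (mem_partr.1 hW1).2
      have heq : insert r (univ.erase r \ k) = univ \ k := by
        ext a
        simp only [mem_insert, mem_sdiff, mem_erase, mem_univ, and_true, true_and]
        constructor
        · rintro (rfl | ⟨-, hak⟩)
          · exact hrk
          · exact hak
        · intro hak
          by_cases har : a = r
          · exact Or.inl har
          · exact Or.inr ⟨har, hak⟩
      rw [heq] at this
      exact this

/-- **No residue instance has `u = univ`.** -/
theorem residue_univ_false (h : Residue F univ) : False := by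
  obtain ⟨r, -, -, hP, -⟩ := exists_two_tight_proj h.htf h.hexc
  rcases sing_t_of_residue h hP with hr | hr
  · exact residue_univ_false_of_singleton h hP hr
  · refine residue_univ_false_of_singleton h.compls ((tight_proj_compls_iff F r).2 hP) ?_
    rw [mem_compls, compl_singleton_eq]
    exact hr

/-- Every residue instance has `u ≠ univ`. -/
theorem Residue.ne_univ {u : Finset α} (h : Residue F u) : u ≠ univ := fun hu =>
  residue_univ_false (hu ▸ h)

end Univ

section ConjV

variable (α)

/-- **`CaseIOfComplex α` holds**: at a complex tight trace `r ∈ u` of a residue instance,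
`u ∖ r ∈ F`. -/
theorem caseIOfComplex : CaseIOfComplex α :=
  caseIOfComplex_of_residue_ne_univ fun _ _ h => h.ne_univ

variable {α}

/-- **CONJECTURE V ON RESIDUE INSTANCES**: the difference family of a residue instance is
`F ∪ {∅}` or `F* ∪ {∅}`. -/
theorem conjV_residue {F : Finset (Finset α)} {u : Finset α} (h : Residue F u) :
    F \\ F = insert ∅ F ∨ F \\ F = insert ∅ (compls F) :=
  conjV_residue_of_caseIOfComplex (caseIOfComplex α) h

end ConjV

end PercRepro.MSTight
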